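import Literature.NumberTheory.Automorphic.HidaTowerLevelActionBridge
import Literature.NumberTheory.Automorphic.HidaTowerLevelsHecke
import HarnessLib

/-!
# Commuting Hecke operators at the levels `U(b, c)` and the action of `ℤ[T^abs]`

Topic `NumberTheory/Automorphic`; namespace `Literature.NumberTheory.Automorphic.BigHeckeGLn.TameLevel`;
definitions with bodies (`laPolyHom`, `hidaPolyHomAt`) and theorems; no named fact, no `sorry`.

For `GL₂` and a tame level `U` maximal above `p`, the Hecke operators of the Hida elements
(`T_{w,j}`, `T_{w,2}⁻¹` at good `w`, `U_{v,j}`, `U_{v,2}⁻¹`, `⟨u⟩_v` at `v ∣ p`) commute on the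
trivial-coefficient cohomology of EVERY two-parameter Hida level `U(b, c)` (`heckeFun_level_comm`,
the argument of `HidaTowerHeckeCommutative` for `U(r) = U(r, max r 1)` verbatim: factorizability
`isUnramifiedLevel_levelAt`, Gelfand's trick at good places, and at `v ∣ p` one of two Hida elements is
`t_{v,1}` while the other normalises `U(b,c)`), hence on `H^i(U(b,c), 1; k/p^s)` of the level-action
model (`laHecke_comm`).  Consequently the polynomial ring `ℤ[T^abs] = ℤ[X_g : g Hida element]` acts on
each `H^i(U(b,c), 1; ℤ/p^s)` through a ring homomorphism **`laPolyHom`** into the (commutative)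
subring generated by these operators, `X_g ↦ [U g U]`; level-action maps commuting with the `[U g U]`
commute with the whole action (`comp_polyHom_eq_of_forall_X`), and along the bridge
`towerBridge : H^i(X_{U(r)}, ℤ/p^s) ≅ H^i(U(r, max r 1), 1; ℤ/p^s)` the action `hidaPolyHom` through
`𝕋^S(𝒰; p)` corresponds to `laPolyHom` (`towerBridge_hom_comp_hidaPolyHomAt`), so that
**`forall_smul_eq_zero_iff_laPolyHom`**: `z` kills `H^i(X_{U(r)}, ℤ/p^s)^{ord}` iff `laPolyHom z`
kills the level-action ordinary part `laOrd`.

[cite: KhareThorne2017, §6.2, Lemma 6.5; §6.5] [cite: Hida1994AIF, §1–§3]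

## References

* C. Khare, J. A. Thorne, Amer. J. Math. 139 (2017), §6.2, §6.5. [KhareThorne2017]
* H. Hida, Ann. Inst. Fourier 44 (1994), §1–3. [Hida1994AIF]
-/

noncomputable section

open CategoryTheory IsDedekindDomain
open scoped NumberField

namespace Literature.NumberTheory.Automorphic

/-! ### Generic: maps commuting with generators commute with polynomial actions -/

/-- **A map intertwining the generators intertwines the polynomial actions**: for ring
homomorphisms `f_A : ℤ[X_σ] → End A`, `f_B : ℤ[X_σ] → End B` and an additive map `Φ : A → B` with
`Φ ∘ f_A(X_g) = f_B(X_g) ∘ Φ` for all `g`, `Φ ∘ f_A(z) = f_B(z) ∘ Φ` for all `z`. [folklore] -/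
theorem comp_polyHom_eq_of_forall_X {σ k A B : Type} [Ring k] [AddCommGroup A] [AddCommGroup B]
    [Module k A] [Module k B]
    (fA : MvPolynomial σ ℤ →+* Module.End k A) (fB : MvPolynomial σ ℤ →+* Module.End k B)
    (Φ : A →ₗ[k] B) (h : ∀ g : σ, Φ ∘ₗ fA (MvPolynomial.X g) = fB (MvPolynomial.X g) ∘ₗ Φ)
    (z : MvPolynomial σ ℤ) : Φ ∘ₗ fA z = fB z ∘ₗ Φ := by
  induction z using MvPolynomial.induction_on with
  | C a =>
    rw [eq_intCast, map_intCast, map_intCast]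
    refine LinearMap.ext fun m => ?_
    simp only [LinearMap.coe_comp, Function.comp_apply, Module.End.intCast_apply, map_zsmul]
  | add p q hp hq => rw [map_add, map_add, LinearMap.comp_add, LinearMap.add_comp, hp, hq]
  | mul_X q g hq =>
    rw [map_mul, map_mul, Module.End.mul_eq_comp, Module.End.mul_eq_comp, ← LinearMap.comp_assoc, hq,
      LinearMap.comp_assoc, h g, ← LinearMap.comp_assoc]

namespace BigHeckeGLn

namespace TameLevel

open LevelAction

variable {K : Type} [Field K] [NumberField K] {p : ℕ} [Fact p.Prime] (𝒰 : TameLevel 2 K p)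

/-! ### Hecke operators of Hida elements commute on `H^i(U(b,c), 1; k/p^s)` -/

/-- **The Hecke operators of Hida elements commute on `H^i(U(b,c), 1; k/p^s)`** (level-action model).
[cite: KhareThorne2017, §6.2, Lemma 6.5] -/
theorem laHecke_comm (h𝒰 : 𝒰.IsMaximalAbove) (k : Type) [CommRing k] (b c s : ℕ)
    {g g' : FiniteAdelicGL 2 K} (hg : g ∈ 𝒰.hidaElements) (hg' : g' ∈ 𝒰.hidaElements) (i : ℕ) :
    𝒰.laHecke k b c s g i * 𝒰.laHecke k b c s g' i = 𝒰.laHecke k b c s g' i * 𝒰.laHecke k b c s g i := by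
  have hAQ := heckeEnd_level_comm 𝒰 h𝒰 k (modPow k (p : k) s) b c hg hg' i
  rw [Module.End.mul_eq_comp, Module.End.mul_eq_comp] at hAQ
  have hg1 := ModuleCat.inv_hom_comp_eq_of_hom_comp _ (𝒰.laIso_hom_comp_laHecke k b c s g i)
  have hg2 := ModuleCat.inv_hom_comp_eq_of_hom_comp _ (𝒰.laIso_hom_comp_laHecke k b c s g' i)
  have hih : (𝒰.laIso k b c s i).inv.hom ∘ₗ (𝒰.laIso k b c s i).hom.hom = LinearMap.id := by
    rw [← ModuleCat.hom_comp, Iso.hom_inv_id, ModuleCat.hom_id]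
  -- conjugate by `laIso`: `T_g T_g' = e⁻¹ A_g A_g' e`
  have key : ∀ {x y : FiniteAdelicGL 2 K},
      (𝒰.laIso k b c s i).inv.hom ∘ₗ ArithmeticQuotient.heckeEnd k (𝒰.level b c) x (modPow k (p : k) s)
          (globalEmbedding 2 K) i = 𝒰.laHecke k b c s x i ∘ₗ (𝒰.laIso k b c s i).inv.hom →
      (𝒰.laIso k b c s i).inv.hom ∘ₗ ArithmeticQuotient.heckeEnd k (𝒰.level b c) y (modPow k (p : k) s)
          (globalEmbedding 2 K) i = 𝒰.laHecke k b c s y i ∘ₗ (𝒰.laIso k b c s i).inv.hom →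
      𝒰.laHecke k b c s x i * 𝒰.laHecke k b c s y i =
        (𝒰.laIso k b c s i).inv.hom ∘ₗ (ArithmeticQuotient.heckeEnd k (𝒰.level b c) x (modPow k (p : k) s)
          (globalEmbedding 2 K) i ∘ₗ ArithmeticQuotient.heckeEnd k (𝒰.level b c) y (modPow k (p : k) s)
          (globalEmbedding 2 K) i) ∘ₗ (𝒰.laIso k b c s i).hom.hom := by
    intro x y hx hy
    symm
    set Ax := ArithmeticQuotient.heckeEnd k (𝒰.level b c) x (modPow k (p : k) s) (globalEmbedding 2 K) i
    set Ay := ArithmeticQuotient.heckeEnd k (𝒰.level b c) y (modPow k (p : k) s) (globalEmbedding 2 K) i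
    set eh := (𝒰.laIso k b c s i).hom.hom
    set ei := (𝒰.laIso k b c s i).inv.hom
    rw [LinearMap.comp_assoc eh Ay Ax, ← LinearMap.comp_assoc (Ay ∘ₗ eh) Ax ei, hx,
      LinearMap.comp_assoc _ ei (𝒰.laHecke k b c s x i), ← LinearMap.comp_assoc eh Ay ei, hy,
      LinearMap.comp_assoc eh ei (𝒰.laHecke k b c s y i), hih, LinearMap.comp_id, ← Module.End.mul_eq_comp]
  rw [key hg1 hg2, key hg2 hg1, hAQ]

/-! ### The action of `ℤ[T^abs]` on `H^i(U(b,c), 1; ℤ/p^s)` -/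

/-- The set of Hecke operators of Hida elements on `H^i(U(b,c), 1; k/p^s)`. [folklore] -/
def laHeckeSet (k : Type) [CommRing k] (b c s i : ℕ) : Set (Module.End k (𝒰.laCohomology k b c s i)) :=
  {T | ∃ g ∈ 𝒰.hidaElements, T = 𝒰.laHecke k b c s g i}

/-- These operators pairwise commute. [cite: KhareThorne2017, §6.2, Lemma 6.5] -/
theorem laHeckeSet_comm (h𝒰 : 𝒰.IsMaximalAbove) (k : Type) [CommRing k] (b c s i : ℕ) :
    ∀ T ∈ 𝒰.laHeckeSet k b c s i, ∀ T' ∈ 𝒰.laHeckeSet k b c s i, T * T' = T' * T := by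
  rintro _ ⟨g, hg, rfl⟩ _ ⟨g', hg', rfl⟩
  exact 𝒰.laHecke_comm h𝒰 k b c s hg hg' i

/-- The subring of `End H^i(U(b,c), 1; ℤ/p^s)` generated by the operators of the Hida elements is
commutative. [cite: KhareThorne2017, §6.2, Lemma 6.5] -/
instance commRingClosureLaHeckeSet [h𝒰 : Fact 𝒰.IsMaximalAbove] (b c s i : ℕ) :
    CommRing (Subring.closure (𝒰.laHeckeSet ℤ b c s i)) :=
  { (inferInstance : Ring (Subring.closure (𝒰.laHeckeSet ℤ b c s i))) with
    mul_comm := (Subring.isMulCommutative_closure (𝒰.laHeckeSet_comm h𝒰.out ℤ b c s i)).is_comm.comm }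

/-- **`ℤ[T^abs] → End H^i(U(b,c), 1; ℤ/p^s)`, `X_g ↦ [U g U]`**: the action of the polynomial Hecke
ring through the commutative subring generated by the operators of the Hida elements.
[cite: KhareThorne2017, §6.5] -/
def laPolyHom [Fact 𝒰.IsMaximalAbove] (b c s i : ℕ) :
    MvPolynomial 𝒰.hidaElements ℤ →+* Module.End ℤ (𝒰.laCohomology ℤ b c s i) :=
  (Subring.closure (𝒰.laHeckeSet ℤ b c s i)).subtype.comp
    (MvPolynomial.eval₂Hom (Int.castRingHom _) fun g =>
      ⟨𝒰.laHecke ℤ b c s g.1 i, Subring.subset_closure ⟨g.1, g.2, rfl⟩⟩)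

/-- `laPolyHom (X_g) = [U g U]`. [folklore] -/
@[simp]
theorem laPolyHom_X [Fact 𝒰.IsMaximalAbove] (b c s i : ℕ) (g : 𝒰.hidaElements) :
    𝒰.laPolyHom b c s i (MvPolynomial.X g) = 𝒰.laHecke ℤ b c s g.1 i := by
  rw [laPolyHom, RingHom.comp_apply, MvPolynomial.coe_eval₂Hom, MvPolynomial.eval₂_X]
  rfl

/-- **A level-action map commuting with the `[U g U]` of all Hida elements commutes with `ℤ[T^abs]`.**
[folklore] -/
theorem comp_laPolyHom_eq [Fact 𝒰.IsMaximalAbove] {b c s i b' c' s' i' : ℕ}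
    (Φ : 𝒰.laCohomology ℤ b c s i →ₗ[ℤ] 𝒰.laCohomology ℤ b' c' s' i')
    (hΦ : ∀ g ∈ 𝒰.hidaElements, Φ ∘ₗ 𝒰.laHecke ℤ b c s g i = 𝒰.laHecke ℤ b' c' s' g i' ∘ₗ Φ)
    (z : MvPolynomial 𝒰.hidaElements ℤ) :
    Φ ∘ₗ 𝒰.laPolyHom b c s i z = 𝒰.laPolyHom b' c' s' i' z ∘ₗ Φ := by
  refine comp_polyHom_eq_of_forall_X (𝒰.laPolyHom b c s i) (𝒰.laPolyHom b' c' s' i') Φ (fun g => ?_) z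
  rw [laPolyHom_X, laPolyHom_X]
  exact hΦ g.1 g.2

/-- An endomorphism commuting with the `[U g U]` of all Hida elements commutes with `ℤ[T^abs]`
(e.g. `[U g U]` itself). [folklore] -/
theorem laHecke_comp_laPolyHom [h𝒰 : Fact 𝒰.IsMaximalAbove] {b c s i : ℕ} {g : FiniteAdelicGL 2 K}
    (hg : g ∈ 𝒰.hidaElements) (z : MvPolynomial 𝒰.hidaElements ℤ) :
    𝒰.laHecke ℤ b c s g i ∘ₗ 𝒰.laPolyHom b c s i z = 𝒰.laPolyHom b c s i z ∘ₗ 𝒰.laHecke ℤ b c s g i :=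
  𝒰.comp_laPolyHom_eq _ (fun g' hg' => by
    rw [← Module.End.mul_eq_comp, ← Module.End.mul_eq_comp, 𝒰.laHecke_comm h𝒰.out ℤ b c s hg hg' i]) z

/-- `laPolyHom z` preserves `laOrd`. [folklore] -/
theorem laPolyHom_apply_mem_laOrd [Fact 𝒰.IsMaximalAbove] {b c s i : ℕ} (z : MvPolynomial 𝒰.hidaElements ℤ)
    {x : 𝒰.laCohomology ℤ b c s i} (hx : x ∈ 𝒰.laOrd ℤ b c s i) :
    𝒰.laPolyHom b c s i z x ∈ 𝒰.laOrd ℤ b c s i := by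
  simp only [laOrd, Submodule.mem_iInf] at hx ⊢
  intro v
  exact (Submodule.mem_iInf _).1 (mapsTo_iInf_range_pow_of_comp_eq
    (𝒰.laHecke_comp_laPolyHom (heckeElement_mem_hidaElements 𝒰 (Or.inr v.2) 1) z).symm
    ((Submodule.mem_iInf _).2 (hx v)))

/-! ### Compatibility with the tower side -/

/-- **`ℤ[T^abs] → End H^i(X_{U(r)}, ℤ/p^s)` through `𝕋^S(𝒰; p)`**: `z ↦ (hidaPolyHom z)_y`.
[folklore] -/
def hidaPolyHomAt [Fact 𝒰.IsMaximalAbove] (y : TowerIndex) :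
    MvPolynomial 𝒰.hidaElements ℤ →+* Module.End ℤ (𝒰.hidaCohomology ℤ y) where
  toFun z := HidaEndFactor.toEnd 𝒰 ℤ (((𝒰.hidaPolyHom z : HidaHeckeAlgebraGLn 𝒰) : 𝒰.hidaEndProd ℤ) y)
  map_one' := by rw [map_one]; rfl
  map_mul' z z' := by rw [map_mul]; rfl
  map_zero' := by rw [map_zero]; rfl
  map_add' z z' := by rw [map_add]; rfl

/-- Unfolding `hidaPolyHomAt`. [folklore] -/
theorem hidaPolyHomAt_apply [Fact 𝒰.IsMaximalAbove] (y : TowerIndex) (z : MvPolynomial 𝒰.hidaElements ℤ) :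
    𝒰.hidaPolyHomAt y z =
      HidaEndFactor.toEnd 𝒰 ℤ (((𝒰.hidaPolyHom z : HidaHeckeAlgebraGLn 𝒰) : 𝒰.hidaEndProd ℤ) y) :=
  rfl

/-- `hidaPolyHomAt y (X_g) = [U(r) g U(r)]`. [folklore] -/
theorem hidaPolyHomAt_X [Fact 𝒰.IsMaximalAbove] (y : TowerIndex) (g : 𝒰.hidaElements) :
    𝒰.hidaPolyHomAt y (MvPolynomial.X g) = HidaEndFactor.toEnd 𝒰 ℤ (𝒰.hidaFamily ℤ g.1 y) := by
  rw [hidaPolyHomAt_apply, hidaPolyHom_X]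
  rfl

/-- **The bridge intertwines the two actions of `ℤ[T^abs]`**:
`Φ ∘ (hidaPolyHom z)_{(i,r,s)} = laPolyHom z ∘ Φ`. [folklore] -/
theorem towerBridge_hom_comp_hidaPolyHomAt [Fact 𝒰.IsMaximalAbove] (r s i : ℕ)
    (z : MvPolynomial 𝒰.hidaElements ℤ) :
    (𝒰.towerBridge ℤ r s i).hom.hom ∘ₗ 𝒰.hidaPolyHomAt (i, r, s) z =
      𝒰.laPolyHom r (max r 1) s i z ∘ₗ (𝒰.towerBridge ℤ r s i).hom.hom := by
  refine comp_polyHom_eq_of_forall_X (𝒰.hidaPolyHomAt (i, r, s)) (𝒰.laPolyHom r (max r 1) s i) _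
    (fun g => ?_) z
  rw [hidaPolyHomAt_X, laPolyHom_X]
  exact 𝒰.towerBridge_hom_comp_hidaFamily ℤ r s g.1 i

/-- **`z` kills `H^i(X_{U(r)}, ℤ/p^s)^{ord}` iff `laPolyHom z` kills `laOrd`.** [folklore] -/
theorem forall_smul_eq_zero_iff_laPolyHom [Fact 𝒰.IsMaximalAbove] (r s i : ℕ)
    (z : MvPolynomial 𝒰.hidaElements ℤ) :
    (∀ m : 𝒰.ordinaryPart ℤ (i, r, s), z • m = 0) ↔
      ∀ x ∈ 𝒰.laOrd ℤ r (max r 1) s i, 𝒰.laPolyHom r (max r 1) s i z x = 0 := by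
  have h𝒰 : 𝒰.IsMaximalAbove := Fact.out
  have hcomp := fun m : 𝒰.hidaCohomology ℤ (i, r, s) =>
    LinearMap.congr_fun (𝒰.towerBridge_hom_comp_hidaPolyHomAt r s i z) m
  simp only [LinearMap.coe_comp, Function.comp_apply] at hcomp
  have hinj := (𝒰.towerBridge ℤ r s i).toLinearEquiv.injective
  constructor
  · intro h x hx
    -- `x = Φ m` with `m` ordinary
    obtain ⟨m, hm, rfl⟩ : x ∈ (𝒰.ordinaryPart ℤ (i, r, s)).map (𝒰.towerBridge ℤ r s i).hom.hom := by
      rwa [𝒰.map_ordinaryPart_towerBridge ℤ h𝒰]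
    have hzm := congrArg Subtype.val (h ⟨m, hm⟩)
    rw [coe_heckePoly_smul, ZeroMemClass.coe_zero] at hzm
    change (𝒰.hidaPolyHomAt (i, r, s) z) m = 0 at hzm
    rw [← hcomp, hzm, map_zero]
  · intro h m
    refine Subtype.ext (hinj ?_)
    rw [coe_heckePoly_smul, ZeroMemClass.coe_zero, map_zero]
    change (𝒰.towerBridge ℤ r s i).hom.hom ((𝒰.hidaPolyHomAt (i, r, s) z) m) = 0
    rw [hcomp]
    exact h _ ((𝒰.mem_ordinaryPart_iff_towerBridge ℤ h𝒰 r s i _).1 m.2)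

end TameLevel

end BigHeckeGLn

end Literature.NumberTheory.Automorphic
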